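import Literature.NumberTheory.LFunctions.WeilWindowSimpleEven
import Literature.NumberTheory.LFunctions.WeilGroundState
import Literature.NumberTheory.LFunctions.WeilMellinBounds
import Mathlib.Topology.MetricSpace.ProperSpace
import Mathlib.Analysis.Normed.Module.FiniteDimension
import HarnessLib

/-!
# Line `cofinite-weil-index-staircase`, stub `stub_zeroLevelWindow` — finite-span infrastructure

Helper file (`--supports stmt-RiemannHypothesis-2064`, crux `RuelleBand.CofiniteCriticalLine`) for
the stub `stub_zeroLevelWindow` proved in
`RuelleBandCofiniteCriticalLineStubZeroLevelWindow.lean`.  Normalisation of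
`Literature/NumberTheory/LFunctions/WeilExplicit.lean`: `Q = weilQuadratic`, `W = weilFunctional`,
tests `IsWeilTest`, `g̃ = weilReflect g`, `⋆ = weilConv`.

Contents (all elementary, all proved):
* `stub_zeroLevelWindow_form_sum_sum` — the SESQUILINEAR EXPANSION
  `B(∑ cᵢ gᵢ, ∑ dⱼ gⱼ) = ∑ᵢⱼ cᵢ conj dⱼ B(gᵢ, gⱼ)` for any form `B` that is bi-additive and
  (conjugate-)homogeneous on test functions, and the resulting continuity in the coefficients
  (`stub_zeroLevelWindow_form_continuous`);
* its two instances: `c ↦ Q(∑ cᵢ gᵢ)` is continuous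
  (`stub_zeroLevelWindow_continuous_weilQuadratic`, from `weilConv_add_left/right`,
  `weilFunctional_add`, `weilConv_const_mul_left/right`, `weilReflect_const_mul`,
  `weilFunctional_const_mul`) and `c ↦ ∫ ‖∑ cᵢ gᵢ‖²` is continuous
  (`stub_zeroLevelWindow_continuous_normSq`);
* bookkeeping for linear combinations `t ↦ ∑ cᵢ gᵢ(t)` of test functions: test property, window
  support, scaling `∫ ‖r F‖² = r² ∫ ‖F‖²`, `Re Q(r F) = r² Re Q(F)` (`weilQuadratic_const_mul`),
  linear independence versus vanishing combinations, positivity of `∫ ‖∑ cᵢ gᵢ‖²` for `c ≠ 0`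
  (`IsWeilTest.eq_zero_of_integral_norm_sq_eq_zero`) and `L²`-normalisation.

No definitions, no named facts; Bombieri 2000 §4 / Yoshida 1992 ("`T[f * f̄*]` is a hermitian
form") is the only mathematics used, through the tree's proved additivity lemmas.
-/

-- the namespace segment `RiemannHypothesis` repeats (single-problem summit); harmless here
set_option linter.dupNamespace false

noncomputable section

open Complex MeasureTheory Filter Set
open scoped BigOperators Topology ComplexConjugate

namespace Summit.RiemannHypothesis.RiemannHypothesis.Theorems.RuelleBandCofiniteCriticalLine

open Literature.NumberTheory.LFunctions

/-- The zero function is a Weil test function. [folklore] -/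
theorem stub_zeroLevelWindow_isWeilTest_zero : IsWeilTest (0 : ℝ → ℂ) :=
  ⟨contDiff_const, HasCompactSupport.zero⟩

/-- Pointwise form of a finite linear combination: `t ↦ ∑ cᵢ gᵢ(t)` is `∑ cᵢ • gᵢ`. [folklore] -/
theorem stub_zeroLevelWindow_sum_eq {n : ℕ} (c : Fin n → ℂ) (g : Fin n → ℝ → ℂ) :
    (fun t => ∑ i, c i * g i t) = ∑ i, c i • g i := by
  funext t
  simp [Finset.sum_apply]

/-- Finite linear combinations of test functions are test functions. [folklore] -/
theorem stub_zeroLevelWindow_isWeilTest_sum {n : ℕ} (s : Finset (Fin n)) (c : Fin n → ℂ)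
    {g : Fin n → ℝ → ℂ} (hg : ∀ i, IsWeilTest (g i)) :
    IsWeilTest (∑ i ∈ s, c i • g i) := by
  refine Finset.sum_induction _ IsWeilTest (fun _ _ => IsWeilTest.add)
    stub_zeroLevelWindow_isWeilTest_zero (fun i _ => ?_)
  exact (hg i).const_mul (c i)

/-- Expansion of a form that is additive and homogeneous in its left argument (on test functions)
over a finite linear combination of test functions. [folklore] -/
theorem stub_zeroLevelWindow_form_sum_left (B : (ℝ → ℂ) → (ℝ → ℂ) → ℂ)
    (hadd : ∀ f₁ f₂ h, IsWeilTest f₁ → IsWeilTest f₂ → IsWeilTest h →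
      B (f₁ + f₂) h = B f₁ h + B f₂ h)
    (hmul : ∀ (a : ℂ) (f h : ℝ → ℂ), IsWeilTest f → IsWeilTest h → B (a • f) h = a * B f h)
    {n : ℕ} {g : Fin n → ℝ → ℂ} (hg : ∀ i, IsWeilTest (g i)) {h : ℝ → ℂ} (hh : IsWeilTest h)
    (c : Fin n → ℂ) (s : Finset (Fin n)) :
    B (∑ i ∈ s, c i • g i) h = ∑ i ∈ s, c i * B (g i) h := by
  induction s using Finset.induction_on with
  | empty =>
    have h0 := hmul 0 h h hh hh
    rw [zero_smul, zero_mul] at h0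
    simpa using h0
  | insert a s ha ih =>
    rw [Finset.sum_insert ha, Finset.sum_insert ha,
      hadd (c a • g a) _ _ ((hg a).const_mul (c a)) (stub_zeroLevelWindow_isWeilTest_sum s c hg)
        hh, hmul _ _ _ (hg a) hh, ih]

/-- Expansion of a form that is additive and conjugate-homogeneous in its right argument (on test
functions) over a finite linear combination of test functions. [folklore] -/
theorem stub_zeroLevelWindow_form_sum_right (B : (ℝ → ℂ) → (ℝ → ℂ) → ℂ)
    (hadd : ∀ f h₁ h₂, IsWeilTest f → IsWeilTest h₁ → IsWeilTest h₂ →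
      B f (h₁ + h₂) = B f h₁ + B f h₂)
    (hmul : ∀ (a : ℂ) (f h : ℝ → ℂ), IsWeilTest f → IsWeilTest h → B f (a • h) = conj a * B f h)
    {n : ℕ} {g : Fin n → ℝ → ℂ} (hg : ∀ i, IsWeilTest (g i)) {f : ℝ → ℂ} (hf : IsWeilTest f)
    (c : Fin n → ℂ) (s : Finset (Fin n)) :
    B f (∑ i ∈ s, c i • g i) = ∑ i ∈ s, conj (c i) * B f (g i) := by
  induction s using Finset.induction_on with
  | empty =>
    have h0 := hmul 0 f f hf hf
    rw [zero_smul, map_zero, zero_mul] at h0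
    simpa using h0
  | insert a s ha ih =>
    rw [Finset.sum_insert ha, Finset.sum_insert ha,
      hadd f (c a • g a) _ hf ((hg a).const_mul (c a))
        (stub_zeroLevelWindow_isWeilTest_sum s c hg), hmul _ _ _ hf (hg a), ih]

/-- **Sesquilinear expansion.** For a form `B` that is bi-additive, homogeneous in the first and
conjugate-homogeneous in the second argument on test functions:
`B(∑ cᵢ gᵢ, ∑ dⱼ gⱼ) = ∑ᵢ ∑ⱼ cᵢ conj(dⱼ) B(gᵢ, gⱼ)`. [folklore] -/
theorem stub_zeroLevelWindow_form_sum_sum (B : (ℝ → ℂ) → (ℝ → ℂ) → ℂ)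
    (hadd_l : ∀ f₁ f₂ h, IsWeilTest f₁ → IsWeilTest f₂ → IsWeilTest h →
      B (f₁ + f₂) h = B f₁ h + B f₂ h)
    (hadd_r : ∀ f h₁ h₂, IsWeilTest f → IsWeilTest h₁ → IsWeilTest h₂ →
      B f (h₁ + h₂) = B f h₁ + B f h₂)
    (hmul_l : ∀ (a : ℂ) (f h : ℝ → ℂ), IsWeilTest f → IsWeilTest h → B (a • f) h = a * B f h)
    (hmul_r : ∀ (a : ℂ) (f h : ℝ → ℂ), IsWeilTest f → IsWeilTest h →
      B f (a • h) = conj a * B f h)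
    {n : ℕ} {g : Fin n → ℝ → ℂ} (hg : ∀ i, IsWeilTest (g i)) (c d : Fin n → ℂ) :
    B (∑ i, c i • g i) (∑ j, d j • g j) = ∑ i, ∑ j, c i * conj (d j) * B (g i) (g j) := by
  rw [stub_zeroLevelWindow_form_sum_left B hadd_l hmul_l hg
    (stub_zeroLevelWindow_isWeilTest_sum Finset.univ d hg) c Finset.univ]
  refine Finset.sum_congr rfl fun i _ => ?_
  rw [stub_zeroLevelWindow_form_sum_right B hadd_r hmul_r hg (hg i) d Finset.univ, Finset.mul_sum]
  refine Finset.sum_congr rfl fun j _ => ?_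
  ring

/-- Continuity in the coefficients of a sesquilinear form restricted to a finite span of test
functions (it is a polynomial in `c` and `conj c`). [folklore] -/
theorem stub_zeroLevelWindow_form_continuous (B : (ℝ → ℂ) → (ℝ → ℂ) → ℂ)
    (hadd_l : ∀ f₁ f₂ h, IsWeilTest f₁ → IsWeilTest f₂ → IsWeilTest h →
      B (f₁ + f₂) h = B f₁ h + B f₂ h)
    (hadd_r : ∀ f h₁ h₂, IsWeilTest f → IsWeilTest h₁ → IsWeilTest h₂ →
      B f (h₁ + h₂) = B f h₁ + B f h₂)
    (hmul_l : ∀ (a : ℂ) (f h : ℝ → ℂ), IsWeilTest f → IsWeilTest h → B (a • f) h = a * B f h)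
    (hmul_r : ∀ (a : ℂ) (f h : ℝ → ℂ), IsWeilTest f → IsWeilTest h →
      B f (a • h) = conj a * B f h)
    {n : ℕ} {g : Fin n → ℝ → ℂ} (hg : ∀ i, IsWeilTest (g i)) :
    Continuous fun c : Fin n → ℂ => B (∑ i, c i • g i) (∑ j, c j • g j) := by
  have heq : (fun c : Fin n → ℂ => B (∑ i, c i • g i) (∑ j, c j • g j)) =
      fun c => ∑ i, ∑ j, c i * conj (c j) * B (g i) (g j) :=
    funext fun c => stub_zeroLevelWindow_form_sum_sum B hadd_l hadd_r hmul_l hmul_r hg c c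
  rw [heq]
  refine continuous_finsetSum _ fun i _ => continuous_finsetSum _ fun j _ => ?_
  exact (((continuous_apply i).mul (Complex.continuous_conj.comp (continuous_apply j))).mul
    continuous_const)

/-! ### The two forms: Weil's `W(f ⋆ h̃)` and the `L²` inner product -/

/-- `W((f₁ + f₂) ⋆ h̃) = W(f₁ ⋆ h̃) + W(f₂ ⋆ h̃)` on test functions. [folklore] -/
theorem stub_zeroLevelWindow_weil_add_left (f₁ f₂ h : ℝ → ℂ) (hf₁ : IsWeilTest f₁)
    (hf₂ : IsWeilTest f₂) (hh : IsWeilTest h) :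
    weilFunctional (weilConv (f₁ + f₂) (weilReflect h)) =
      weilFunctional (weilConv f₁ (weilReflect h)) +
        weilFunctional (weilConv f₂ (weilReflect h)) := by
  rw [weilConv_add_left hf₁ hf₂ hh.weilReflect,
    weilFunctional_add (hf₁.weilConv hh.weilReflect) (hf₂.weilConv hh.weilReflect)]

/-- `W(f ⋆ (h₁ + h₂)̃) = W(f ⋆ h̃₁) + W(f ⋆ h̃₂)` on test functions. [folklore] -/
theorem stub_zeroLevelWindow_weil_add_right (f h₁ h₂ : ℝ → ℂ) (hf : IsWeilTest f)
    (hh₁ : IsWeilTest h₁) (hh₂ : IsWeilTest h₂) :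
    weilFunctional (weilConv f (weilReflect (h₁ + h₂))) =
      weilFunctional (weilConv f (weilReflect h₁)) +
        weilFunctional (weilConv f (weilReflect h₂)) := by
  rw [weilReflect_add, weilConv_add_right hf hh₁.weilReflect hh₂.weilReflect,
    weilFunctional_add (hf.weilConv hh₁.weilReflect) (hf.weilConv hh₂.weilReflect)]

/-- **`c ↦ Q(∑ cᵢ gᵢ)` is continuous** on the coefficient space, for test functions `gᵢ`
(`Q(∑ cᵢ gᵢ) = ∑ᵢⱼ cᵢ conj cⱼ W(gᵢ ⋆ g̃ⱼ)` is a polynomial in `c, conj c`). [folklore] -/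
theorem stub_zeroLevelWindow_continuous_weilQuadratic {n : ℕ} {g : Fin n → ℝ → ℂ}
    (hg : ∀ i, IsWeilTest (g i)) :
    Continuous fun c : Fin n → ℂ => weilQuadratic (fun t => ∑ i, c i * g i t) := by
  have h := stub_zeroLevelWindow_form_continuous
    (fun f h => weilFunctional (weilConv f (weilReflect h)))
    (fun f₁ f₂ h hf₁ hf₂ hh => stub_zeroLevelWindow_weil_add_left f₁ f₂ h hf₁ hf₂ hh)
    (fun f h₁ h₂ hf hh₁ hh₂ => stub_zeroLevelWindow_weil_add_right f h₁ h₂ hf hh₁ hh₂)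
    (fun a f h _ _ => by
      rw [show a • f = fun t => a * f t from rfl, weilConv_const_mul_left, weilFunctional_const_mul])
    (fun a f h _ _ => by
      rw [show a • h = fun t => a * h t from rfl, weilReflect_const_mul, weilConv_const_mul_right,
        weilFunctional_const_mul]) hg
  simp_rw [stub_zeroLevelWindow_sum_eq]
  exact h

/-- `∫ (f₁ + f₂) conj h = ∫ f₁ conj h + ∫ f₂ conj h` for test functions. [folklore] -/
theorem stub_zeroLevelWindow_inner_add_left (f₁ f₂ h : ℝ → ℂ) (hf₁ : IsWeilTest f₁)
    (hf₂ : IsWeilTest f₂) (hh : IsWeilTest h) :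
    ∫ t, (f₁ + f₂) t * conj (h t) = (∫ t, f₁ t * conj (h t)) + ∫ t, f₂ t * conj (h t) := by
  rw [← integral_add (hf₁.integrable_mul (by have := hh.1.continuous; fun_prop))
    (hf₂.integrable_mul (by have := hh.1.continuous; fun_prop))]
  congr 1 with t
  simp only [Pi.add_apply]
  ring

/-- `∫ f conj (h₁ + h₂) = ∫ f conj h₁ + ∫ f conj h₂` for test functions. [folklore] -/
theorem stub_zeroLevelWindow_inner_add_right (f h₁ h₂ : ℝ → ℂ) (hf : IsWeilTest f)
    (hh₁ : IsWeilTest h₁) (hh₂ : IsWeilTest h₂) :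
    ∫ t, f t * conj ((h₁ + h₂) t) = (∫ t, f t * conj (h₁ t)) + ∫ t, f t * conj (h₂ t) := by
  rw [← integral_add (hf.integrable_mul (by have := hh₁.1.continuous; fun_prop))
    (hf.integrable_mul (by have := hh₂.1.continuous; fun_prop))]
  congr 1 with t
  simp only [Pi.add_apply, map_add]
  ring

/-- `∫ (a f) conj h = a ∫ f conj h`. [folklore] -/
theorem stub_zeroLevelWindow_inner_smul_left (a : ℂ) (f h : ℝ → ℂ) :
    ∫ t, (a • f) t * conj (h t) = a * ∫ t, f t * conj (h t) := by
  rw [← integral_const_mul]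
  congr 1 with t
  simp only [Pi.smul_apply, smul_eq_mul]
  ring

/-- `∫ f conj (a h) = conj a ∫ f conj h`. [folklore] -/
theorem stub_zeroLevelWindow_inner_smul_right (a : ℂ) (f h : ℝ → ℂ) :
    ∫ t, f t * conj ((a • h) t) = conj a * ∫ t, f t * conj (h t) := by
  rw [← integral_const_mul]
  congr 1 with t
  simp only [Pi.smul_apply, smul_eq_mul, map_mul]
  ring

/-- `∫ F conj F = ∫ ‖F‖²` (as a complex number). [folklore] -/
theorem stub_zeroLevelWindow_inner_self (F : ℝ → ℂ) :
    ∫ t, F t * conj (F t) = ((∫ t, ‖F t‖ ^ 2 : ℝ) : ℂ) := by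
  rw [← integral_complex_ofReal]
  congr 1 with t
  rw [Complex.mul_conj, Complex.normSq_eq_norm_sq]

/-- **`c ↦ ∫ ‖∑ cᵢ gᵢ‖²` is continuous** on the coefficient space, for test functions `gᵢ`
(`= ∑ᵢⱼ cᵢ conj cⱼ ∫ gᵢ conj gⱼ`). [folklore] -/
theorem stub_zeroLevelWindow_continuous_normSq {n : ℕ} {g : Fin n → ℝ → ℂ}
    (hg : ∀ i, IsWeilTest (g i)) :
    Continuous fun c : Fin n → ℂ => ∫ t, ‖∑ i, c i * g i t‖ ^ 2 := by
  have h := stub_zeroLevelWindow_form_continuous (fun f h => ∫ t, f t * conj (h t))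
    (fun f₁ f₂ h hf₁ hf₂ hh => stub_zeroLevelWindow_inner_add_left f₁ f₂ h hf₁ hf₂ hh)
    (fun f h₁ h₂ hf hh₁ hh₂ => stub_zeroLevelWindow_inner_add_right f h₁ h₂ hf hh₁ hh₂)
    (fun a f h _ _ => stub_zeroLevelWindow_inner_smul_left a f h)
    (fun a f h _ _ => stub_zeroLevelWindow_inner_smul_right a f h) hg
  simp_rw [stub_zeroLevelWindow_inner_self] at h
  have h2 := Complex.continuous_re.comp h
  simp_rw [Function.comp_def, Complex.ofReal_re] at h2
  convert h2 using 2 with c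
  congr 1 with t
  rw [← stub_zeroLevelWindow_sum_eq]

/-! ### Linear combinations: support, scaling, linear independence -/

/-- A combination of functions supported in the window `[-a, a]` is supported there. [folklore] -/
theorem stub_zeroLevelWindow_tsupport_sum_subset {n : ℕ} {g : Fin n → ℝ → ℂ} {a : ℝ}
    (hsupp : ∀ i, tsupport (g i) ⊆ Set.Icc (-a) a) (c : Fin n → ℂ) :
    tsupport (fun t => ∑ i, c i * g i t) ⊆ Set.Icc (-a) a := by
  refine closure_minimal (fun t ht => ?_) isClosed_Icc
  by_contra hta
  refine ht (Finset.sum_eq_zero fun i _ => ?_)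
  rw [image_eq_zero_of_notMem_tsupport fun h => hta (hsupp i h), mul_zero]

/-- Pulling a common scalar out of a combination (pointwise). [folklore] -/
theorem stub_zeroLevelWindow_sum_smul_apply {n : ℕ} (r : ℂ) (c : Fin n → ℂ) (g : Fin n → ℝ → ℂ)
    (t : ℝ) : ∑ i, r * c i * g i t = r * ∑ i, c i * g i t := by
  rw [Finset.mul_sum]
  exact Finset.sum_congr rfl fun i _ => mul_assoc _ _ _

/-- Pulling a common scalar out of a combination. [folklore] -/
theorem stub_zeroLevelWindow_sum_smul {n : ℕ} (r : ℂ) (c : Fin n → ℂ) (g : Fin n → ℝ → ℂ) :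
    (fun t => ∑ i, r * c i * g i t) = fun t => r * ∑ i, c i * g i t :=
  funext (stub_zeroLevelWindow_sum_smul_apply r c g)

/-- `∫ ‖∑ (r cᵢ) gᵢ‖² = r² ∫ ‖∑ cᵢ gᵢ‖²` for real `r`. [folklore] -/
theorem stub_zeroLevelWindow_normSq_smul {n : ℕ} (r : ℝ) (c : Fin n → ℂ) (g : Fin n → ℝ → ℂ) :
    ∫ t, ‖∑ i, (r : ℂ) * c i * g i t‖ ^ 2 = r ^ 2 * ∫ t, ‖∑ i, c i * g i t‖ ^ 2 := by
  rw [← integral_const_mul]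
  congr 1 with t
  rw [stub_zeroLevelWindow_sum_smul_apply, norm_mul, mul_pow, Complex.norm_real,
    Real.norm_eq_abs, sq_abs]

/-- `Re Q(∑ (r cᵢ) gᵢ) = r² Re Q(∑ cᵢ gᵢ)` for real `r` (`weilQuadratic_const_mul`). [folklore] -/
theorem stub_zeroLevelWindow_re_weilQuadratic_smul {n : ℕ} (r : ℝ) (c : Fin n → ℂ)
    (g : Fin n → ℝ → ℂ) :
    (weilQuadratic (fun t => ∑ i, (r : ℂ) * c i * g i t)).re =
      r ^ 2 * (weilQuadratic (fun t => ∑ i, c i * g i t)).re := by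
  rw [stub_zeroLevelWindow_sum_smul, weilQuadratic_const_mul, Complex.normSq_ofReal,
    Complex.re_ofReal_mul]
  ring

/-- For a linearly independent tuple, a vanishing combination has zero coefficients. [folklore] -/
theorem stub_zeroLevelWindow_coeff_eq_zero {n : ℕ} {g : Fin n → ℝ → ℂ}
    (hli : LinearIndependent ℂ g) {c : Fin n → ℂ} (hc : (fun t => ∑ i, c i * g i t) = 0) :
    c = 0 := by
  rw [stub_zeroLevelWindow_sum_eq] at hc
  exact funext fun i => Fintype.linearIndependent_iff.1 hli c hc i

/-- For a linearly independent tuple of test functions and `c ≠ 0`, `∫ ‖∑ cᵢ gᵢ‖² > 0`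
(a test function with vanishing `L²`-norm is zero). [folklore] -/
theorem stub_zeroLevelWindow_normSq_pos {n : ℕ} {g : Fin n → ℝ → ℂ} (hg : ∀ i, IsWeilTest (g i))
    (hli : LinearIndependent ℂ g) {c : Fin n → ℂ} (hc : c ≠ 0) :
    0 < ∫ t, ‖∑ i, c i * g i t‖ ^ 2 := by
  have hnn : 0 ≤ ∫ t, ‖∑ i, c i * g i t‖ ^ 2 := integral_nonneg fun _ => by positivity
  rcases hnn.eq_or_lt with hz | hpos
  · exfalso
    have hF : IsWeilTest (fun t => ∑ i, c i * g i t) := by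
      rw [stub_zeroLevelWindow_sum_eq]
      exact stub_zeroLevelWindow_isWeilTest_sum Finset.univ c hg
    exact hc (stub_zeroLevelWindow_coeff_eq_zero hli
      (hF.eq_zero_of_integral_norm_sq_eq_zero hz.symm))
  · exact hpos

/-- **Normalisation**: for a linearly independent tuple of test functions and `c ≠ 0` there is
`r > 0` with `∫ ‖∑ (r cᵢ) gᵢ‖² = 1`. [folklore] -/
theorem stub_zeroLevelWindow_normalise {n : ℕ} {g : Fin n → ℝ → ℂ} (hg : ∀ i, IsWeilTest (g i))
    (hli : LinearIndependent ℂ g) {c : Fin n → ℂ} (hc : c ≠ 0) :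
    ∃ r : ℝ, 0 < r ∧ ∫ t, ‖∑ i, (r : ℂ) * c i * g i t‖ ^ 2 = (1 : ℝ) := by
  have hm := stub_zeroLevelWindow_normSq_pos hg hli hc
  refine ⟨(Real.sqrt (∫ t, ‖∑ i, c i * g i t‖ ^ 2))⁻¹, inv_pos.2 (Real.sqrt_pos.2 hm), ?_⟩
  rw [stub_zeroLevelWindow_normSq_smul, inv_pow, Real.sq_sqrt hm.le, inv_mul_cancel₀ hm.ne']

end Summit.RiemannHypothesis.RiemannHypothesis.Theorems.RuelleBandCofiniteCriticalLine

end
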